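import Summits.HubbardSuperconductivity.HubbardSuperconductivity.Theorems.WeakCouplingBCSWcbcsSsbToTorusLROReduction
import Summits.HubbardSuperconductivity.HubbardSuperconductivity.Theorems.WeakCouplingBCSWcbcsBcsConstructionThinSufficiency
import HarnessLib

/-!
# Route `WeakCouplingBCS` — the whole open content after the two cruxes' line work, kernel-composed:
# (T) torus pair stiffness → (N) neutral-curvature floor → (C) charging floor → thin `d`-wave order → `HubbardSuperconductivity`

Lead c3 of crux `WcbcsSsbToTorusLRO` (stmt-HubbardSuperconductivity-2009, line `off-zero-mode-moment-closure`), 2026-08-17.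

Crux 2 (`WcbcsSsbToTorusLRO`, SSB ⇒ every-GS torus LRO) is closed modulo its three registered physical stubs by the landed reduction
`WcbcsSsbToTorusLRO.wcbcsSsbToTorusLRO_of_stiffness_curvature_charging` (p91563); crux 4's lead (stmt-2010, line
`ladder-scale-certified-chain`, c4) landed `stub_summitOfThinOrder` (p144261): crux 2 and THIN ORDER — `d_{x²-y²}` symmetry breaking
(`HasDWaveOrder U μ`) on some `μ`-sub-interval of `[-21/25, -7/20]` at arbitrarily small `U`, no rate, no density clause — give the
summit. This file composes the two BY NAME: the route reaches `HubbardSuperconductivity` from exactly four statements of mathematical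
physics about the weakly repulsive 2-d Hubbard torus, each in its registered (U-uniform, `∃ U₀ ∀ U ∀ δ ∀ μ`-guarded) form —

* (T) `stub_torusPairStiffness` — every-ground-state torus pair stiffness (Goldstone-form pair susceptibility ceiling `≤ C L²/|q|²` from each
  neighbouring sector's own bottom, with the momentum-alignment clause);
* (N) `stub_neutralCurvature` — the `h`-uniform floor `≥ -C_R κ² L²` on the neutral (Kac-block) second difference of the sourced
  grand-canonical ground energy;
* (C) `stub_chargingFloor` — the pair excitation gap of the canonical problem at the pinned filling is `≥ -ε/(1+log L)` eventually;
* (M′) thin `d`-wave order at arbitrarily weak repulsion —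

and nothing else (sorry-free, standard axioms). It certifies that the split children of `Cruxes/WcbcsSsbToTorusLRO/SPLIT-TNC.md`
(T, N, C VERBATIM, U-uniform) are compatible with the thin composition of crux 4 (a `δ`-first repackaging of crux 2 would not be:
`Cruxes/WcbcsBcsConstruction/LINE-STATUS.md` caveat 2). Nothing here proves (T), (N), (C) or (M′): they are four outputs of one
constructive engine (a symmetry-broken weak-coupling expansion for the 2-d Hubbard ground state) that does not exist.
References: T. Koma, H. Tasaki, J. Stat. Phys. 76 (1994) 745, §0.7/§1; G. Benfatto, A. Giuliani, V. Mastropietro,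
Ann. Henri Poincaré 7 (2006) 809, Thm 1.1 (the expansion stops at `T ≥ e^{-a/U}`).
-/

noncomputable section

set_option linter.dupNamespace false

namespace Summit.HubbardSuperconductivity.HubbardSuperconductivity.Theorems.WcbcsSsbToTorusLRO

open Literature.MathematicalPhysics.QuantumLattice Literature.Probability.LatticeModels
open Matrix Filter Set
open scoped ComplexOrder ComplexConjugate

/-- **The route's residue, composed.** (T) torus pair stiffness → (N) neutral-curvature floor → (C) charging floor — the three
registered stubs of crux `WcbcsSsbToTorusLRO` verbatim — → thin `d`-wave order on a `μ`-sub-interval of `[-21/25,-7/20]` at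
arbitrarily small `U` → the summit `HubbardSuperconductivity`: `stub_summitOfThinOrder` (p144261) after
`wcbcsSsbToTorusLRO_of_stiffness_curvature_charging` (p91563). [cite: KomaTasaki1994, §0.7] -/
theorem hubbardSuperconductivity_of_stiffness_curvature_charging_thinOrder : (∃ U₀ : ℝ, 0 < U₀ ∧ ∀ U ∈ Set.Ioo (0:ℝ) U₀, ∀ δ ∈ Set.Ioo (0:ℝ) (1 / 2), ∀ μ : ℝ, Filter.Tendsto (fun L : ℕ => ((hubbardTorusWith 2 (L + 1) 1 U μ).groundStateFunctional totalNumber).re / ((L + 1 : ℕ) : ℝ) ^ 2) Filter.atTop (nhds (1 - δ)) → HasDWaveOrder U μ → ∃ C η : ℝ, 0 < η ∧ ∀ᶠ k : ℕ in Filter.atTop, ∀ ψ : Fock (Orb (FermionTorus 2 (2 * k + 1 + 1))), IsGroundStateInSector (hubbardTorus 2 (2 * k + 1 + 1) 1 U) (2 * ⌊(1 - δ) * ((2 * k + 1 + 1 : ℕ) : ℝ) ^ 2 / 2⌋₊) 0 ψ → star ψ ⬝ᵥ ψ = 1 → ∀ m : TorusSite 2 (2 * k + 1 + 1), m ≠ 0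 → momentumNormSq (2 * k + 1 + 1) m < η ^ 2 → (∀ w : Fock (Orb (FermionTorus 2 (2 * k + 1 + 1))), w ∈ szSector (Λ := FermionTorus 2 (2 * k + 1 + 1)) (2 * ⌊(1 - δ) * ((2 * k + 1 + 1 : ℕ) : ℝ) ^ 2 / 2⌋₊ - 2) 0 → 2 * (star w ⬝ᵥ (pairFieldAt dWaveFormFactor (2 * k + 1 + 1) m *ᵥ ψ)).re - ((star w ⬝ᵥ (hubbardTorus 2 (2 * k + 1 + 1) 1 U *ᵥ w)).re - (hubbardTorus 2 (2 * k + 1 + 1) 1 U).minEnergyOn (szSector (2 * ⌊(1 - δ) * ((2 * k + 1 + 1 : ℕ) : ℝ) ^ 2 / 2⌋₊ - 2) 0) * (star w ⬝ᵥ w).re) ≤ C * ((2 * k + 1 + 1 : ℕ) : ℝ) ^ 2 / momentumNormSq (2 * k + 1 + 1) m) ∧ (∀ w : Fock (Orb (FermionTorus 2 (2 * k + 1 + 1))), w ∈ szSector (Λ := FermionTorus 2 (2 * k + 1 + 1)) (2 * ⌊(1 - δ) * ((2 * k + 1 + 1 : ℕ) : ℝ) ^ 2 / 2⌋₊ + 2)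 0 → 2 * (star w ⬝ᵥ ((pairFieldAt dWaveFormFactor (2 * k + 1 + 1) m)ᴴ *ᵥ ψ)).re - ((star w ⬝ᵥ (hubbardTorus 2 (2 * k + 1 + 1) 1 U *ᵥ w)).re - (hubbardTorus 2 (2 * k + 1 + 1) 1 U).minEnergyOn (szSector (2 * ⌊(1 - δ) * ((2 * k + 1 + 1 : ℕ) : ℝ) ^ 2 / 2⌋₊ + 2) 0) * (star w ⬝ᵥ w).re) ≤ C * ((2 * k + 1 + 1 : ℕ) : ℝ) ^ 2 / momentumNormSq (2 * k + 1 + 1) m)) → (∃ U₀ : ℝ, 0 < U₀ ∧ ∀ U ∈ Set.Ioo (0:ℝ) U₀, ∀ δ ∈ Set.Ioo (0:ℝ) (1 / 2), ∀ μ : ℝ, Filter.Tendsto (fun L : ℕ => ((hubbardTorusWith 2 (L + 1) 1 U μ).groundStateFunctional totalNumber).re / ((L + 1 : ℕ) : ℝ) ^ 2) Filter.atTop (nhds (1 - δ)) → HasDWaveOrder U μ → ∀ R : ℕ, 0 < R → ∃ C : ℝ, 0 ≤ C ∧ ∃ κ₀ : ℝ, 0 < κ₀ ∧ ∃ h₀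 : ℝ, 0 < h₀ ∧ ∀ κ ∈ Set.Ioo (0:ℝ) κ₀, ∀ h ∈ Set.Ioo (0:ℝ) h₀, ∀ᶠ L : ℕ in Filter.atTop, -C * κ ^ 2 * ((L + 1 : ℕ) : ℝ) ^ 2 ≤ (dWaveSourceTorus (L + 1) U μ h + (κ : ℂ) • (((((R : ℝ) ^ 4)⁻¹ : ℝ) : ℂ) • ∑ a : Literature.Probability.LatticeModels.TorusSite 2 (L + 1), (∑ u : Fin 2 → Fin R, localPair dWaveFormFactor (L + 1) (a + fun i => ((u i : ℕ) : ZMod (L + 1))))ᴴ * (∑ u : Fin 2 → Fin R, localPair dWaveFormFactor (L + 1) (a + fun i => ((u i : ℕ) : ZMod (L + 1)))))).groundEnergy + (dWaveSourceTorus (L + 1) U μ h + ((-κ : ℝ) : ℂ) • (((((R : ℝ) ^ 4)⁻¹ : ℝ) : ℂ) • ∑ a : Literature.Probability.LatticeModels.TorusSite 2 (L + 1), (∑ u : Fin 2 → Fin R, localPair dWaveFormFactor (L + 1) (a + fun i => ((u i : ℕ) : ZMod (L + 1))))ᴴ * (∑ u : Fin 2 → Fin R, localPair dWaveFormFactor (L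 + 1) (a + fun i => ((u i : ℕ) : ZMod (L + 1)))))).groundEnergy - 2 * (dWaveSourceTorus (L + 1) U μ h).groundEnergy) → (∃ U₀ : ℝ, 0 < U₀ ∧ ∀ U ∈ Set.Ioo (0:ℝ) U₀, ∀ δ ∈ Set.Ioo (0:ℝ) (1 / 2), ∀ μ : ℝ, Filter.Tendsto (fun L : ℕ => ((hubbardTorusWith 2 (L + 1) 1 U μ).groundStateFunctional totalNumber).re / ((L + 1 : ℕ) : ℝ) ^ 2) Filter.atTop (nhds (1 - δ)) → HasDWaveOrder U μ → ∀ ε : ℝ, 0 < ε → ∀ᶠ k : ℕ in Filter.atTop, -ε ≤ (1 + Real.log ((2 * k + 1 + 1 : ℕ) : ℝ)) * pairGap (hubbardTorus 2 (2 * k + 1 + 1) 1 U) (2 * ⌊(1 - δ) * ((2 * k + 1 + 1 : ℕ) : ℝ) ^ 2 / 2⌋₊)) → (∀ U₁ : ℝ, 0 < U₁ → ∃ U ∈ Set.Ioo (0:ℝ) U₁, ∃ a b : ℝ, -(21:ℝ) / 25 ≤ a ∧ a < b ∧ b ≤ -(7:ℝ) / 20 ∧ ∀ μ ∈ Set.Ioo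 a b, HasDWaveOrder U μ) → _root_.HubbardSuperconductivity :=
  fun hT hN hC hM =>
    Summit.HubbardSuperconductivity.HubbardSuperconductivity.Theorems.stub_summitOfThinOrder
      (wcbcsSsbToTorusLRO_of_stiffness_curvature_charging hT hN hC) hM

end Summit.HubbardSuperconductivity.HubbardSuperconductivity.Theorems.WcbcsSsbToTorusLRO

end
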